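import Mathlib
import HarnessLib
import Summits.ValiantsHypothesis.ValiantsHypothesis.Theorems.LacunarySymmetroidMatrixDescartesProductPlusOneSlopeMixedCloud
import Summits.ValiantsHypothesis.ValiantsHypothesis.Theorems.LacunarySymmetroidMatrixDescartesProductPlusOneSlopeCoherent

/-!
# LINE (A) `product_plus_one`, floor in W-currency: the ρ_I = 1 cell in a MIXED company (incoherent pullers + ALREADY-SWITCHED coherent rows), LINE currency

Line-currency wrapper of ✓/⧗ `…SlopeMixedCloud` (`oneRiser_mixedCloud_no_three_zeros`): K = 3, `d 1 = d 0 + e₁ + 1`, `d 2 = d 1 + e₂ + 1`; riser row `j₀`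
(`a_{j₀0} ≥ 0`, `a_{j₀1} < 0`, `a_{j₀2} < 0`) switched on the window `[x₁, x₃] ⊂ (0,∞)`; every other row is EITHER an incoherent puller (`a_{j0} > 0`,
`a_{j1} ≤ 0`, `a_{j2} ≤ 0`, `a_{j1} + a_{j2} < 0`) unswitched at the right end `x₃`, OR a coherent row (`a_{j0} > 0`, `a_{j1} > 0`, `a_{j2} < 0`) already switched at the
left end `x₁` (`f_j(x₁) < 0`; it then stays switched: `coherent_value_neg_of_ge`).  Then:
* ★★ `oneRiser_mixedCompany_wronskian_no_three_zeros` — `W(∏_j Σ_l C a_{jl} X^{d_l})` does not vanish at three points of the window;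
* ★ `oneRiser_mixedCompany_wronskian_roots_le_two` / ★★ `oneRiser_mixedCompany_eulerNumerator_roots_le_three` — ≤ 2 zeros of `W(P)` in `(u,v)`, ≤ 3 zeros of
  `eulerNumerator d a l₀` in `[u,v]` for EVERY coupling (riser switched on `[u,v]`, pullers unswitched at `v`, coherent rows switched at `u`).
This is the far side of the card's «T4 + T5 at ratio > 4» core: once the coherent rows have switched they are pulls, and the first interaction cell keeps its count.
HONEST FRAMING: one cell; coherent rows between turning point and zero, several humps, `OneChangeFloorK3`, `WronskianBudgetK3`, the stubs, `MatrixDescartes` OPEN;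
`VP ≠ VNP` NOT proved.  No definitions, no named facts.
-/

set_option linter.dupNamespace false

namespace Summit.ValiantsHypothesis.ValiantsHypothesis.Theorems.LacunarySymmetroidMatrixDescartes

namespace ProductPlusOne

open Finset Polynomial
open scoped BigOperators Polynomial

/-- `F/x^q` is non-increasing for `A ≥ 0`, `B ≤ 0`: `0 < x ≤ x₂ ⇒ F(x₂)·x^q ≤ F(x)·x₂^q` (`F = A − Bx^p − Cx^q`). [folklore] -/
theorem coherent_value_scaled_mono (e₁ e₂ : ℕ) (A B C : ℝ) (hA : 0 ≤ A) (hB : B ≤ 0) {x x₂ : ℝ} (hx : 0 < x) (hle : x ≤ x₂) :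
    (A - B * x₂ ^ (e₁ + 1) - C * x₂ ^ (e₁ + e₂ + 2)) * x ^ (e₁ + e₂ + 2)
      ≤ (A - B * x ^ (e₁ + 1) - C * x ^ (e₁ + e₂ + 2)) * x₂ ^ (e₁ + e₂ + 2) := by
  have hx2 : 0 < x₂ := hx.trans_le hle
  have hq : x ^ (e₁ + e₂ + 2) ≤ x₂ ^ (e₁ + e₂ + 2) := pow_le_pow_left₀ hx.le hle _
  have hA' : A * x ^ (e₁ + e₂ + 2) ≤ A * x₂ ^ (e₁ + e₂ + 2) := mul_le_mul_of_nonneg_left hq hA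
  have hB' : -B * x₂ ^ (e₁ + 1) * x ^ (e₁ + e₂ + 2) ≤ -B * x ^ (e₁ + 1) * x₂ ^ (e₁ + e₂ + 2) := by
    have : x₂ ^ (e₁ + 1) * x ^ (e₁ + e₂ + 2) ≤ x ^ (e₁ + 1) * x₂ ^ (e₁ + e₂ + 2) := by
      have hexp : e₁ + e₂ + 2 = (e₁ + 1) + (e₂ + 1) := by omega
      have e : x₂ ^ (e₁ + e₂ + 2) = x₂ ^ (e₁ + 1) * x₂ ^ (e₂ + 1) := by rw [hexp, pow_add]
      have e' : x ^ (e₁ + e₂ + 2) = x ^ (e₁ + 1) * x ^ (e₂ + 1) := by rw [hexp, pow_add]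
      rw [e, e']
      have h1 : x ^ (e₂ + 1) ≤ x₂ ^ (e₂ + 1) := pow_le_pow_left₀ hx.le hle _
      have : 0 ≤ x₂ ^ (e₁ + 1) * x ^ (e₁ + 1) := by positivity
      nlinarith
    have hnB : 0 ≤ -B := by linarith
    nlinarith
  nlinarith

/-- A coherent row switched at `x₁` stays switched: `A ≥ 0`, `B ≤ 0`, `F(x₁) < 0`, `0 < x₁ ≤ x ⇒ F(x) < 0`. [this file's lemma] -/
theorem coherent_value_neg_of_ge (e₁ e₂ : ℕ) (A B C : ℝ) (hA : 0 ≤ A) (hB : B ≤ 0) {x₁ x : ℝ} (h0 : 0 < x₁) (hle : x₁ ≤ x)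
    (h1 : A - B * x₁ ^ (e₁ + 1) - C * x₁ ^ (e₁ + e₂ + 2) < 0) :
    A - B * x ^ (e₁ + 1) - C * x ^ (e₁ + e₂ + 2) < 0 := by
  have hx : 0 < x := h0.trans_le hle
  have key := coherent_value_scaled_mono e₁ e₂ A B C hA hB h0 hle
  have hneg : (A - B * x₁ ^ (e₁ + 1) - C * x₁ ^ (e₁ + e₂ + 2)) * x ^ (e₁ + e₂ + 2) < 0 := mul_neg_of_neg_of_pos h1 (pow_pos hx _)
  have hlt : (A - B * x ^ (e₁ + 1) - C * x ^ (e₁ + e₂ + 2)) * x₁ ^ (e₁ + e₂ + 2) < 0 := lt_of_le_of_lt key hneg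
  by_contra h
  push Not at h
  have : 0 ≤ (A - B * x ^ (e₁ + 1) - C * x ^ (e₁ + e₂ + 2)) * x₁ ^ (e₁ + e₂ + 2) := mul_nonneg h (pow_pos h0 _).le
  linarith

/-- ★★ **ONE SWITCHED INCOHERENT RISER IN A MIXED COMPANY: the company's log-Wronskian has NO THREE ZEROS on the window** (LINE currency). [this file's theorem] -/
theorem oneRiser_mixedCompany_wronskian_no_three_zeros {m : ℕ} (d : Fin 3 → ℕ) (e₁ e₂ : ℕ)
    (he₁ : d 1 = d 0 + e₁ + 1) (he₂ : d 2 = d 1 + e₂ + 1)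
    (a : Fin m → Fin 3 → ℝ) (j₀ : Fin m) (hr0 : 0 ≤ a j₀ 0) (hr1 : a j₀ 1 < 0) (hr2 : a j₀ 2 < 0)
    {x₁ x₂ x₃ : ℝ} (h0 : 0 < x₁) (h12' : x₁ < x₂) (h23 : x₂ < x₃)
    (hcls : ∀ j, j ≠ j₀ →
      (0 < a j 0 ∧ a j 1 ≤ 0 ∧ a j 2 ≤ 0 ∧ a j 1 + a j 2 < 0 ∧ 0 < (∑ l, C (a j l) * X ^ (d l) : ℝ[X]).eval x₃) ∨
      (0 < a j 0 ∧ 0 < a j 1 ∧ a j 2 < 0 ∧ (∑ l, C (a j l) * X ^ (d l) : ℝ[X]).eval x₁ < 0))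
    (hsw : ∀ x ∈ Set.Icc x₁ x₃, (∑ l, C (a j₀ l) * X ^ (d l) : ℝ[X]).eval x < 0)
    (hzero : ∀ x ∈ ({x₁, x₂, x₃} : Set ℝ),
      ((∏ j, ∑ l, C (a j l) * X ^ (d l) : ℝ[X]) * (X * derivative (X * derivative (∏ j, ∑ l, C (a j l) * X ^ (d l) : ℝ[X])))
        - (X * derivative (∏ j, ∑ l, C (a j l) * X ^ (d l) : ℝ[X])) ^ 2).eval x = 0) : False := by
  classical
  have hd := fin3_support_eq_gaps d e₁ e₂ he₁ he₂
  have hev : ∀ j x, (∑ l, C (a j l) * X ^ (d l) : ℝ[X]).eval x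
        = x ^ (d 0) * (a j 0 - (-(a j 1)) * x ^ (e₁ + 1) - (-(a j 2)) * x ^ (e₁ + e₂ + 2)) := by
    intro j x
    have h := (eval_trinomial_three (d 0) (e₁ + 1) (e₁ + e₂ + 2) (a j) x).1
    rw [hd] at h; rw [h]; ring
  have h13 : x₁ < x₃ := h12'.trans h23
  have hIcc : ∀ x ∈ ({x₁, x₂, x₃} : Set ℝ), x ∈ Set.Icc x₁ x₃ := by
    intro x hx
    simp only [Set.mem_insert_iff, Set.mem_singleton_iff] at hx
    rcases hx with h | h | h <;> (subst h; constructor <;> linarith)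
  have hx3 : 0 < x₃ := h0.trans h13
  -- riser in normal form
  have hsw' : ∀ x ∈ Set.Icc x₁ x₃, a j₀ 0 - (-(a j₀ 1)) * x ^ (e₁ + 1) - (-(a j₀ 2)) * x ^ (e₁ + e₂ + 2) < 0 := by
    intro x hx
    have h := hsw x hx
    rw [hev] at h
    exact ((mul_neg_iff.1 h).resolve_right (fun h' => absurd (pow_pos (h0.trans_le hx.1) _) (not_lt.2 h'.1.le))).2
  -- the other rows, pointwise on the window, in mixed-cloud form
  have hrow : ∀ x ∈ Set.Icc x₁ x₃, ∀ j ∈ Finset.univ.erase j₀,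
      (0 ≤ -(a j 1) ∧ 0 ≤ -(a j 2) ∧ 0 < -(a j 1) + -(a j 2) ∧ 0 < a j 0 - (-(a j 1)) * x ^ (e₁ + 1) - (-(a j 2)) * x ^ (e₁ + e₂ + 2))
      ∨ (0 < a j 0 ∧ -(a j 1) < 0 ∧ 0 < -(a j 2) ∧ a j 0 - (-(a j 1)) * x ^ (e₁ + 1) - (-(a j 2)) * x ^ (e₁ + e₂ + 2) < 0) := by
    intro x hx j hj
    have hj' := Finset.ne_of_mem_erase hj
    have hx0 : 0 < x := h0.trans_le hx.1
    rcases hcls j hj' with ⟨_, h1, h2, h12, hun⟩ | ⟨hA, h1, h2, hsw1⟩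
    · left
      rw [hev] at hun
      have h3 : 0 < a j 0 - (-(a j 1)) * x₃ ^ (e₁ + 1) - (-(a j 2)) * x₃ ^ (e₁ + e₂ + 2) :=
        (mul_pos_iff_of_pos_left (pow_pos hx3 _)).1 hun
      have hm1 : a j 1 * x₃ ^ (e₁ + 1) ≤ a j 1 * x ^ (e₁ + 1) := mul_le_mul_of_nonpos_left (pow_le_pow_left₀ hx0.le hx.2 _) h1
      have hm2 : a j 2 * x₃ ^ (e₁ + e₂ + 2) ≤ a j 2 * x ^ (e₁ + e₂ + 2) := mul_le_mul_of_nonpos_left (pow_le_pow_left₀ hx0.le hx.2 _) h2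
      exact ⟨by linarith, by linarith, by linarith, by linarith⟩
    · right
      rw [hev] at hsw1
      have h1' : a j 0 - (-(a j 1)) * x₁ ^ (e₁ + 1) - (-(a j 2)) * x₁ ^ (e₁ + e₂ + 2) < 0 :=
        ((mul_neg_iff.1 hsw1).resolve_right (fun h' => absurd (pow_pos h0 _) (not_lt.2 h'.1.le))).2
      exact ⟨hA, by linarith, by linarith, coherent_value_neg_of_ge e₁ e₂ (a j 0) (-(a j 1)) (-(a j 2)) hA.le (by linarith) h0 hx.1 h1'⟩
  -- no row vanishes on the window
  have hf : ∀ x ∈ Set.Icc x₁ x₃, ∀ j, (∑ l, C (a j l) * X ^ (d l) : ℝ[X]).eval x ≠ 0 := by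
    intro x hx j
    have hx0 : 0 < x := h0.trans_le hx.1
    rw [hev]
    refine mul_ne_zero (pow_ne_zero _ hx0.ne') ?_
    by_cases hj : j = j₀
    · subst hj; exact (hsw' x hx).ne
    · rcases hrow x hx j (Finset.mem_erase.2 ⟨hj, Finset.mem_univ _⟩) with ⟨_, _, _, h⟩ | ⟨_, _, _, h⟩
      · exact h.ne'
      · exact h.ne
  -- the slope-form sum vanishes at the three points
  have hzero' : ∀ x ∈ ({x₁, x₂, x₃} : Set ℝ),
      rowPsi1 e₁ e₂ (a j₀ 0) (-(a j₀ 1)) (-(a j₀ 2)) x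
        + cloudP1 e₁ e₂ (Finset.univ.erase j₀) (fun _ => (1 : ℝ)) (fun j => a j 0) (fun j => -(a j 1)) (fun j => -(a j 2)) x = 0 := by
    intro x hx
    have hxI := hIcc x hx
    have hx0 : 0 < x := h0.trans_le hxI.1
    have h := hzero x hx
    rw [logWronskian_prod_eq_rowPsi1_sum d e₁ e₂ he₁ he₂ a hx0 (hf x hxI)] at h
    have hP : ((∏ j, (∑ l, C (a j l) * X ^ (d l) : ℝ[X])).eval x) ≠ 0 := by
      rw [eval_prod]; exact Finset.prod_ne_zero_iff.2 fun j _ => hf x hxI j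
    have hS : ∑ j, rowPsi1 e₁ e₂ (a j 0) (-(a j 1)) (-(a j 2)) x = 0 := by
      rcases mul_eq_zero.1 h with h1 | h1
      · exact absurd (neg_eq_zero.1 h1) (pow_ne_zero 2 hP)
      · exact h1
    rw [← Finset.add_sum_erase _ _ (Finset.mem_univ j₀)] at hS
    unfold cloudP1
    simpa only [one_mul] using hS
  rcases (Finset.univ.erase j₀).eq_empty_or_nonempty with hs | hs
  · have h1 := hzero' x₁ (by simp)
    have h2 := hzero' x₂ (by simp)
    rw [hs] at h1 h2
    simp only [cloudP1, Finset.sum_empty, add_zero] at h1 h2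
    have hper := riser_turning_persist e₁ e₂ (a j₀ 0) (-(a j₀ 1)) (-(a j₀ 2)) (by linarith) (by linarith) h0 h13.le hsw'
      h1.le x₂ ⟨h12', h23.le⟩
    exact absurd h2 hper.ne
  · exact oneRiser_mixedCloud_no_three_zeros e₁ e₂ (a := a j₀ 0) (b := -(a j₀ 1)) (c := -(a j₀ 2)) hr0 (by linarith) (by linarith)
      (Finset.univ.erase j₀) hs (fun _ => (1 : ℝ)) (fun j => a j 0) (fun j => -(a j 1)) (fun j => -(a j 2))
      (fun _ _ => one_pos) h0 h12' h23 hsw' hrow hzero'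

/-- ★ **≤ 2 zeros of the company's log-Wronskian on the window** (riser switched on `[u,v]`, pullers unswitched at `v`, coherent rows switched at `u`). -/
theorem oneRiser_mixedCompany_wronskian_roots_le_two {m : ℕ} (d : Fin 3 → ℕ) (e₁ e₂ : ℕ)
    (he₁ : d 1 = d 0 + e₁ + 1) (he₂ : d 2 = d 1 + e₂ + 1)
    (a : Fin m → Fin 3 → ℝ) (j₀ : Fin m) (hr0 : 0 ≤ a j₀ 0) (hr1 : a j₀ 1 < 0) (hr2 : a j₀ 2 < 0)
    {u v : ℝ} (hu : 0 < u)
    (hcls : ∀ j, j ≠ j₀ →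
      (0 < a j 0 ∧ a j 1 ≤ 0 ∧ a j 2 ≤ 0 ∧ a j 1 + a j 2 < 0 ∧ 0 < (∑ l, C (a j l) * X ^ (d l) : ℝ[X]).eval v) ∨
      (0 < a j 0 ∧ 0 < a j 1 ∧ a j 2 < 0 ∧ (∑ l, C (a j l) * X ^ (d l) : ℝ[X]).eval u < 0))
    (hsw : ∀ x ∈ Set.Icc u v, (∑ l, C (a j₀ l) * X ^ (d l) : ℝ[X]).eval x < 0) :
    (((∏ j, ∑ l, C (a j l) * X ^ (d l) : ℝ[X]) * (X * derivative (X * derivative (∏ j, ∑ l, C (a j l) * X ^ (d l) : ℝ[X])))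
        - (X * derivative (∏ j, ∑ l, C (a j l) * X ^ (d l) : ℝ[X])) ^ 2).roots.toFinset.filter (fun w => u < w ∧ w < v)).card ≤ 2 := by
  classical
  set W : ℝ[X] := (∏ j, ∑ l, C (a j l) * X ^ (d l) : ℝ[X]) * (X * derivative (X * derivative (∏ j, ∑ l, C (a j l) * X ^ (d l) : ℝ[X])))
      - (X * derivative (∏ j, ∑ l, C (a j l) * X ^ (d l) : ℝ[X])) ^ 2 with hWdef
  by_contra hgt
  push Not at hgt
  obtain ⟨y₁, hy₁, y₂, hy₂, y₃, hy₃, h12', h23⟩ := exists_three_lt_of_card (T := W.roots.toFinset.filter (fun w => u < w ∧ w < v)) hgt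
  by_cases hW0 : W = 0
  · rw [hW0, roots_zero, Multiset.toFinset_zero, Finset.filter_empty] at hy₁; exact absurd hy₁ (Finset.notMem_empty _)
  rw [mem_filter, Multiset.mem_toFinset, mem_roots hW0] at hy₁ hy₂ hy₃
  have hd := fin3_support_eq_gaps d e₁ e₂ he₁ he₂
  have hev : ∀ j x, (∑ l, C (a j l) * X ^ (d l) : ℝ[X]).eval x
        = x ^ (d 0) * (a j 0 - (-(a j 1)) * x ^ (e₁ + 1) - (-(a j 2)) * x ^ (e₁ + e₂ + 2)) := by
    intro j x
    have h := (eval_trinomial_three (d 0) (e₁ + 1) (e₁ + e₂ + 2) (a j) x).1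
    rw [hd] at h; rw [h]; ring
  have hv0 : 0 < v := hu.trans (hy₁.2.1.trans hy₁.2.2)
  have hy10 : 0 < y₁ := hu.trans hy₁.2.1
  have hy30 : 0 < y₃ := hu.trans hy₃.2.1
  -- transport the class hypotheses from `(u, v)` to `(y₁, y₃)`
  have hcls' : ∀ j, j ≠ j₀ →
      (0 < a j 0 ∧ a j 1 ≤ 0 ∧ a j 2 ≤ 0 ∧ a j 1 + a j 2 < 0 ∧ 0 < (∑ l, C (a j l) * X ^ (d l) : ℝ[X]).eval y₃) ∨
      (0 < a j 0 ∧ 0 < a j 1 ∧ a j 2 < 0 ∧ (∑ l, C (a j l) * X ^ (d l) : ℝ[X]).eval y₁ < 0) := by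
    intro j hj
    rcases hcls j hj with ⟨hA, h1, h2, h12, hun⟩ | ⟨hA, h1, h2, hsw1⟩
    · left
      refine ⟨hA, h1, h2, h12, ?_⟩
      rw [hev] at hun ⊢
      have h3 : 0 < a j 0 - (-(a j 1)) * v ^ (e₁ + 1) - (-(a j 2)) * v ^ (e₁ + e₂ + 2) := (mul_pos_iff_of_pos_left (pow_pos hv0 _)).1 hun
      have hm1 : a j 1 * v ^ (e₁ + 1) ≤ a j 1 * y₃ ^ (e₁ + 1) := mul_le_mul_of_nonpos_left (pow_le_pow_left₀ hy30.le hy₃.2.2.le _) h1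
      have hm2 : a j 2 * v ^ (e₁ + e₂ + 2) ≤ a j 2 * y₃ ^ (e₁ + e₂ + 2) := mul_le_mul_of_nonpos_left (pow_le_pow_left₀ hy30.le hy₃.2.2.le _) h2
      exact mul_pos (pow_pos hy30 _) (by linarith)
    · right
      refine ⟨hA, h1, h2, ?_⟩
      rw [hev] at hsw1 ⊢
      have h1' : a j 0 - (-(a j 1)) * u ^ (e₁ + 1) - (-(a j 2)) * u ^ (e₁ + e₂ + 2) < 0 :=
        ((mul_neg_iff.1 hsw1).resolve_right (fun h' => absurd (pow_pos hu _) (not_lt.2 h'.1.le))).2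
      exact mul_neg_of_pos_of_neg (pow_pos hy10 _)
        (coherent_value_neg_of_ge e₁ e₂ (a j 0) (-(a j 1)) (-(a j 2)) hA.le (by linarith) hu hy₁.2.1.le h1')
  refine oneRiser_mixedCompany_wronskian_no_three_zeros d e₁ e₂ he₁ he₂ a j₀ hr0 hr1 hr2 hy10 h12' h23 hcls'
    (fun x hx => hsw x ⟨hy₁.2.1.le.trans hx.1, hx.2.trans hy₃.2.2.le⟩) ?_
  intro x hx
  simp only [Set.mem_insert_iff, Set.mem_singleton_iff] at hx
  rcases hx with h | h | h <;> subst h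
  · exact hy₁.1
  · exact hy₂.1
  · exact hy₃.1

/-- ★★ **Hence AT MOST THREE zeros of `eulerNumerator d a l₀` on the window, for EVERY coupling `l₀`.** [this file's theorem] -/
theorem oneRiser_mixedCompany_eulerNumerator_roots_le_three {m : ℕ} (d : Fin 3 → ℕ) (e₁ e₂ : ℕ)
    (he₁ : d 1 = d 0 + e₁ + 1) (he₂ : d 2 = d 1 + e₂ + 1)
    (a : Fin m → Fin 3 → ℝ) (j₀ : Fin m) (hr0 : 0 ≤ a j₀ 0) (hr1 : a j₀ 1 < 0) (hr2 : a j₀ 2 < 0)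
    (l₀ : Fin 3) {u v : ℝ} (hu : 0 < u) (huv : u ≤ v)
    (hcls : ∀ j, j ≠ j₀ →
      (0 < a j 0 ∧ a j 1 ≤ 0 ∧ a j 2 ≤ 0 ∧ a j 1 + a j 2 < 0 ∧ 0 < (∑ l, C (a j l) * X ^ (d l) : ℝ[X]).eval v) ∨
      (0 < a j 0 ∧ 0 < a j 1 ∧ a j 2 < 0 ∧ (∑ l, C (a j l) * X ^ (d l) : ℝ[X]).eval u < 0))
    (hsw : ∀ x ∈ Set.Icc u v, (∑ l, C (a j₀ l) * X ^ (d l) : ℝ[X]).eval x < 0) :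
    ((∑ j, (∑ l, C (a j l * ((d l : ℝ) - d l₀)) * X ^ (d l)) * ∏ i ∈ Finset.univ.erase j, (∑ l, C (a i l) * X ^ (d l))
        : ℝ[X]).roots.toFinset.filter (fun t => u ≤ t ∧ t ≤ v)).card ≤ 3 := by
  classical
  have hd := fin3_support_eq_gaps d e₁ e₂ he₁ he₂
  have hev : ∀ j x, (∑ l, C (a j l) * X ^ (d l) : ℝ[X]).eval x
        = x ^ (d 0) * (a j 0 - (-(a j 1)) * x ^ (e₁ + 1) - (-(a j 2)) * x ^ (e₁ + e₂ + 2)) := by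
    intro j x
    have h := (eval_trinomial_three (d 0) (e₁ + 1) (e₁ + e₂ + 2) (a j) x).1
    rw [hd] at h; rw [h]; ring
  have hv0 : 0 < v := hu.trans_le huv
  have hP : ∀ t ∈ Set.Icc u v, (∏ j, (∑ l, C (a j l) * X ^ (d l) : ℝ[X])).eval t ≠ 0 := by
    intro t ht
    have ht0 : 0 < t := hu.trans_le ht.1
    rw [eval_prod]
    refine Finset.prod_ne_zero_iff.2 fun j _ => ?_
    by_cases hj : j = j₀
    · subst hj; exact (hsw t ht).ne
    rw [hev]
    refine mul_ne_zero (pow_ne_zero _ ht0.ne') ?_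
    rcases hcls j hj with ⟨_, h1, h2, _, hun⟩ | ⟨hA, h1, _, hsw1⟩
    · rw [hev] at hun
      have h3 : 0 < a j 0 - (-(a j 1)) * v ^ (e₁ + 1) - (-(a j 2)) * v ^ (e₁ + e₂ + 2) := (mul_pos_iff_of_pos_left (pow_pos hv0 _)).1 hun
      have hm1 : a j 1 * v ^ (e₁ + 1) ≤ a j 1 * t ^ (e₁ + 1) := mul_le_mul_of_nonpos_left (pow_le_pow_left₀ ht0.le ht.2 _) h1
      have hm2 : a j 2 * v ^ (e₁ + e₂ + 2) ≤ a j 2 * t ^ (e₁ + e₂ + 2) := mul_le_mul_of_nonpos_left (pow_le_pow_left₀ ht0.le ht.2 _) h2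
      exact ne_of_gt (by linarith)
    · rw [hev] at hsw1
      have h1' : a j 0 - (-(a j 1)) * u ^ (e₁ + 1) - (-(a j 2)) * u ^ (e₁ + e₂ + 2) < 0 :=
        ((mul_neg_iff.1 hsw1).resolve_right (fun h' => absurd (pow_pos hu _) (not_lt.2 h'.1.le))).2
      exact (coherent_value_neg_of_ge e₁ e₂ (a j 0) (-(a j 1)) (-(a j 2)) hA.le (by linarith) hu ht.1 h1').ne
  have h1 := eulerNumerator_roots_Icc_le_wronskian_roots_add_one d a l₀ hu hP
  have h2 := oneRiser_mixedCompany_wronskian_roots_le_two d e₁ e₂ he₁ he₂ a j₀ hr0 hr1 hr2 hu hcls hsw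
  omega

end ProductPlusOne

end Summit.ValiantsHypothesis.ValiantsHypothesis.Theorems.LacunarySymmetroidMatrixDescartes
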